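import Summits.Ventures.HodgeRepro.QuadEngine

/-!
# Degree 12: every single-class `SumTwo` quadruple has a conjugate pair — kernel rows on the typer tables

Blind re-derivation cell `pub-hodge-repro`, seat `typer` (gen 5).  The check `noSingleClassSumTwo` of
`QuadEngine.lean` evaluated by kernel `decide` on the Cayley tables of the six `(G, c)` of order 12
(`CayleyTable.lean`; `C₆ × C₂` with each of its three involutions).  Together with
`QuadEngine.hasConjPair_of_sumTwo` this says: for every CM type `T` of such a `(G, c)` and all
twists `a, b, d`, if `[T, T·a, T·b, T·d]` is `SumTwo` then two of its corners are conjugate —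
so NO `SumTwo` quadruple without a conjugate pair, of ANY pairing pattern (`(4,1,1)`, `(3,2,1)`,
`(2,2,2)`), is single-class (ROUTE.md §3.4).  The `Finset` form is `QuadFinset.lean`; the same check on
the sealer's own tables is `QuadRowsSealed.lean`.
-/

set_option autoImplicit false

open Summit.Ventures.HodgeRepro.FaceCensus

namespace HodgeRepro

/-- The table of `C₆ × C₂` with its second involution `cc_C6xC2'`. -/
def tableC6xC2' : CMGaloisType 12 := tableOf encC6xC2 cc_C6xC2'

/-- The table of `C₆ × C₂` with its third involution `cc_C6xC2''`. -/
def tableC6xC2'' : CMGaloisType 12 := tableOf encC6xC2 cc_C6xC2''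

namespace QuadEngine

/-- `C₁₂`: the check passes (kernel `decide`). -/
theorem noSingleClassSumTwo_C12 : noSingleClassSumTwo tableC12 = true := by decide +kernel

/-- `C₆ × C₂`, involution `(3, 0)`: the check passes. -/
theorem noSingleClassSumTwo_C6xC2 : noSingleClassSumTwo tableC6xC2 = true := by decide +kernel

/-- `C₆ × C₂`, involution `(0, 1)`: the check passes. -/
theorem noSingleClassSumTwo_C6xC2' : noSingleClassSumTwo tableC6xC2' = true := by decide +kernel

/-- `C₆ × C₂`, involution `(3, 1)`: the check passes. -/
theorem noSingleClassSumTwo_C6xC2'' : noSingleClassSumTwo tableC6xC2'' = true := by decide +kernel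

/-- `D₆`: the check passes. -/
theorem noSingleClassSumTwo_D6 : noSingleClassSumTwo tableD6 = true := by decide +kernel

/-- `Dic₃`: the check passes. -/
theorem noSingleClassSumTwo_Dic3 : noSingleClassSumTwo tableDic3 = true := by decide +kernel

end QuadEngine

end HodgeRepro
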